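import Literature.AlgebraicGeometry.Modules.CechThetaVanishing
import HarnessLib

/-!
# Refining Čech cochains of local homomorphisms along a map of index sets

Continuation of `Modules/CechTheta.lean` (refinement with the SAME index set). For a family of opens
`𝓤 = (U_a)_{a ∈ ι}` of a scheme `X`, a second family `𝓥 = (V_{a'})_{a' ∈ ι'}` and a map of index
sets `τ : ι' → ι` with `V_{a'} ≤ U_{τ a'}` ("`𝓥` refines `𝓤` along `τ`") we construct

* `Cech.refineAlong τ hV m : Čᵐ(𝓤, M) → Čᵐ(𝓥, M)`, `(s_α)_α ↦ (s_{τ∘α}|)_α`, commuting with the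
  cosimplicial structure maps, the Čech differentials (`Cech.refineAlongChainMap`) and the
  augmentations (`Cech.augment_refineAlong`);
* `Cech.restrictFamilyAlong τ hV ω` — the refined cochain of local homomorphisms
  `α ↦ ω_{τ∘α}|_{V_α}`, with `(ω|)♯ = ω♯ ≫ refineAlong` and `d(ω|) = (dω)|`;
* `Cech.classOf_restrictFamilyAlong` — **the `Ext`-class of a cocycle is unchanged by refinement
  along `τ`** (naturality of the iterated connecting classes `θ`, `theta_comp_map` with `μ = 𝟙`).

This is the classical independence of Čech classes of the refinement (Hartshorne III.4, Godement
II.5.7), in the `Ext`-valued form of the tree. Everything is proved; no named facts.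

## References

* R. Hartshorne, *Algebraic Geometry*, GTM 52 (1977), III.4 (Lemma 4.4, Ex. 4.4). [Hartshorne1977]
* R. Godement, *Topologie algébrique et théorie des faisceaux* (1958), II.5.7–5.8.
-/

noncomputable section

universe u

open CategoryTheory CategoryTheory.Abelian AlgebraicGeometry Opposite TopologicalSpace Limits

namespace Literature.AlgebraicGeometry.Modules

namespace Cech

variable {X : Scheme.{u}} {ι ι' : Type u} {U : ι → X.Opens} {V : ι' → X.Opens} {n : ℕ} {E M : X.Modules}
  (τ : ι' → ι) (hV : ∀ a, V a ≤ U (τ a))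

include hV in
/-- Faces refine along `τ`: `V_α ≤ U_{τ∘α}`. [folklore] -/
lemma face_le_face_index {m : ℕ} (α : Fin (m + 1) → ι') : face V α ≤ face U (τ ∘ α) :=
  iInf_mono fun k => hV (α k)

variable (M)

/-- **The refinement map along `τ`**: `Čᵐ(𝓤, M) → Čᵐ(𝓥, M)`, `(s_α)_α ↦ (s_{τ∘α}|_{W ∩ V_α})_α`.
[folklore] -/
def refineAlong (m : ℕ) : obj U m M ⟶ obj V m M :=
  homMk (fun W s α => res M (inf_le_inf_left W (face_le_face_index τ hV α)) ((s : Sections U m M W) (τ ∘ α)))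
    (fun _ s t => funext fun α => by rw [obj_add_apply, map_add]; rfl)
    (fun _ r s => funext fun α => by rw [obj_smul_apply, res_smul, resO_resO]; rfl)
    (fun _ _ i s => funext fun α => by rw [obj_map_apply, res_res, restrict_apply, res_res])

/-- Components of the refinement map. [folklore] -/
@[simp] lemma refineAlong_app_apply (m : ℕ) (W : X.Opens) (s : Γ(obj U m M, W)) (α : Fin (m + 1) → ι') :
    ((refineAlong M τ hV m).app W s : Sections V m M W) α =
      res M (inf_le_inf_left W (face_le_face_index τ hV α)) ((s : Sections U m M W) (τ ∘ α)) := rfl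

/-- Refinement along `τ` commutes with the cosimplicial structure maps. [folklore] -/
lemma structMap_refineAlong {l m : ℕ} (g : Fin (l + 1) → Fin (m + 1)) :
    structMap U m M g ≫ refineAlong M τ hV m = refineAlong M τ hV l ≫ structMap V m M g :=
  hom_ext_to fun W s α => by
    simp only [Scheme.Modules.Hom.comp_app, CategoryTheory.comp_apply, refineAlong_app_apply,
      structMap_app_apply, res_res]
    rfl

/-- Refinement along `τ` commutes with the Čech differentials. [folklore] -/
lemma d_refineAlong (m : ℕ) : d U M m ≫ refineAlong M τ hV (m + 1) = refineAlong M τ hV m ≫ d V M m := by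
  rw [d, d, Preadditive.sum_comp, Preadditive.comp_sum]
  refine Finset.sum_congr rfl fun k _ => ?_
  rw [Preadditive.zsmul_comp, Preadditive.comp_zsmul, structMap_refineAlong]

/-- **The refinement chain map along `τ`**, `Č•(𝓤, M) → Č•(𝓥, M)`. [folklore] -/
def refineAlongChainMap : complex U M ⟶ complex V M where
  f m := refineAlong M τ hV m
  comm' m m' h := by
    cases h
    rw [complex_d, complex_d]
    exact (d_refineAlong M τ hV m).symm

/-- The components of the chain map. [folklore] -/
@[simp] lemma refineAlongChainMap_f (m : ℕ) : (refineAlongChainMap M τ hV).f m = refineAlong M τ hV m := rfl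

/-- Refinement along `τ` commutes with the augmentations. [folklore] -/
lemma augment_refineAlong : augment U M ≫ refineAlong M τ hV 0 = augment V M :=
  hom_ext_to fun W s α => by
    rw [Scheme.Modules.Hom.comp_app, CategoryTheory.comp_apply, refineAlong_app_apply,
      augment_app_apply, augment_app_apply, res_res]

variable {M}

/-- **The cochain of local homomorphisms refined along `τ`**: `α ↦ ω_{τ∘α}|_{V_α}`. [folklore] -/
def restrictFamilyAlong (ω : LocalFamily U n E M) : LocalFamily V n E M :=
  fun α => restrictHom (homOfLE (face_le_face_index τ hV α)) (ω (τ ∘ α))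

/-- Unfolding. [folklore] -/
lemma restrictFamilyAlong_apply (ω : LocalFamily U n E M) (α : Fin (n + 1) → ι') :
    restrictFamilyAlong τ hV ω α = restrictHom (homOfLE (face_le_face_index τ hV α)) (ω (τ ∘ α)) := rfl

/-- `(ω|)♯ = ω♯ ≫ refineAlong`. [folklore] -/
theorem familyHom_restrictFamilyAlong (ω : LocalFamily U n E M) :
    familyHom (restrictFamilyAlong τ hV ω) = familyHom ω ≫ refineAlong M τ hV n := by
  refine hom_ext_to fun W s α => ?_
  rw [familyHom_app_apply, Scheme.Modules.Hom.comp_app, CategoryTheory.comp_apply,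
    refineAlong_app_apply, familyHom_app_apply, restrictFamilyAlong_apply, appLE_restrictHom,
    ← res_res (inf_le_left : W ⊓ face U (τ ∘ α) ≤ W) (inf_le_inf_left W (face_le_face_index τ hV α))]
  exact appLE_map (ω (τ ∘ α)) (homOfLE inf_le_right) (homOfLE _) _

/-- Refinement along `τ` is additive. [folklore] -/
lemma restrictFamilyAlong_add (ω ω' : LocalFamily U n E M) :
    restrictFamilyAlong τ hV (ω + ω') = restrictFamilyAlong τ hV ω + restrictFamilyAlong τ hV ω' := by
  funext α
  exact restrictHom_add _ _ _

/-- Refinement along `τ` of the zero cochain. [folklore] -/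
@[simp] lemma restrictFamilyAlong_zero : restrictFamilyAlong τ hV (0 : LocalFamily U n E M) = 0 := by
  funext α
  exact restrictHom_zero _

/-- **Refinement along `τ` commutes with the Čech differential**: `d(ω|) = (dω)|`. [folklore] -/
theorem dFamily_restrictFamilyAlong (ω : LocalFamily U n E M) :
    dFamily (restrictFamilyAlong τ hV ω) = restrictFamilyAlong τ hV (dFamily ω) := by
  apply familyHom_injective
  rw [← familyHom_comp_d, familyHom_restrictFamilyAlong, familyHom_restrictFamilyAlong, Category.assoc,
    ← d_refineAlong, ← Category.assoc, familyHom_comp_d]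

/-- A refined cocycle is a cocycle. [folklore] -/
theorem dFamily_restrictFamilyAlong_eq_zero (ω : LocalFamily U n E M) (hω : dFamily ω = 0) :
    dFamily (restrictFamilyAlong τ hV ω) = 0 := by
  rw [dFamily_restrictFamilyAlong, hω, restrictFamilyAlong_zero]

variable [HasExt.{u + 1} X.Modules]

/-- **The `Ext`-class of a cocycle is unchanged by refinement along a map of index sets** (both
classes computed with exact augmentations compatible with `Cech.augment`).
[cite: Hartshorne1977, III Lemma 4.4] -/
theorem classOf_restrictFamilyAlong (a : Literature.Algebra.Homology.ExactAugmentation (complex U M) M)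
    (a' : Literature.Algebra.Homology.ExactAugmentation (complex V M) M)
    (ha : a.ε = augment U M) (ha' : a'.ε = augment V M)
    (ω : LocalFamily U n E M) (hω : dFamily ω = 0) :
    classOf a' (restrictFamilyAlong τ hV ω) (dFamily_restrictFamilyAlong_eq_zero τ hV ω hω) = classOf a ω hω := by
  rw [classOf_def, classOf_def]
  have hμ : a.ε ≫ (refineAlongChainMap M τ hV).f 0 = 𝟙 M ≫ a'.ε := by
    rw [ha, ha', Category.id_comp]; exact augment_refineAlong M τ hV
  have h := a.theta_comp_map a' (refineAlongChainMap M τ hV) (𝟙 M) hμ (familyHom ω)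
    (familyHom_comp_d_eq_zero ω hω)
    (Literature.Algebra.Homology.ExactAugmentation.comp_f_d_eq_zero _ _ (familyHom_comp_d_eq_zero ω hω))
  rw [Ext.comp_mk₀_id] at h
  rw [← h]
  exact a'.theta_congr (familyHom_restrictFamilyAlong τ hV ω) _ _

/-- The special case of the canonical exact augmentations of two covers. [folklore] -/
theorem classOf_exactAugmentation_restrictFamilyAlong (hU : iSup U = ⊤) (hVtop : iSup V = ⊤)
    (ω : LocalFamily U n E M) (hω : dFamily ω = 0) :
    classOf (exactAugmentation V M hVtop) (restrictFamilyAlong τ hV ω)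
        (dFamily_restrictFamilyAlong_eq_zero τ hV ω hω) =
      classOf (exactAugmentation U M hU) ω hω :=
  classOf_restrictFamilyAlong τ hV _ _ (exactAugmentation_ε U M hU) (exactAugmentation_ε V M hVtop) ω hω


/-- **Cocycles on two covers that become cohomologous on a common refinement have the same
`Ext`-class**: if `𝓦` refines `𝓤` along `τ` and `𝓤'` along `τ'` and `ω'|_𝓦 = ω|_𝓦 + dλ`, then
`[ω'] = [ω]` (classes for the canonical exact augmentations of the covers `𝓤`, `𝓤'`). This is the
form in which the independence of an obstruction class of all choices is assembled.
[cite: Hartshorne1977, III Lemma 4.4] -/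
theorem classOf_eq_of_common_refinement {κ : Type u} {U' : ι' → X.Opens} {W : κ → X.Opens}
    (σ : κ → ι) (σ' : κ → ι') (hW : ∀ c, W c ≤ U (σ c)) (hW' : ∀ c, W c ≤ U' (σ' c))
    (hU : iSup U = ⊤) (hU' : iSup U' = ⊤) (hWtop : iSup W = ⊤)
    (ω : LocalFamily U (n + 1) E M) (ω' : LocalFamily U' (n + 1) E M) (hω : dFamily ω = 0)
    (hω' : dFamily ω' = 0) (lam : LocalFamily W n E M)
    (h : restrictFamilyAlong σ' hW' ω' = restrictFamilyAlong σ hW ω + dFamily lam) :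
    classOf (exactAugmentation U' M hU') ω' hω' = classOf (exactAugmentation U M hU) ω hω := by
  rw [← classOf_exactAugmentation_restrictFamilyAlong σ hW hU hWtop ω hω,
    ← classOf_exactAugmentation_restrictFamilyAlong σ' hW' hU' hWtop ω' hω']
  exact classOf_eq_of_eq_add_dFamily _ lam _ _ h

end Cech

end Literature.AlgebraicGeometry.Modules

end
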